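import Literature.Analysis.OperatorTheory.PseudospectralEnclosureUnbounded
import HarnessLib

/-!
# Pseudospectral enclosure from a FINITE NET of certified inverse bounds on the circle

Topic `Literature/Analysis/OperatorTheory`; proofs-layer file (theorems only, no definitions, no named facts), in
the frame of `InverseNormSpectrumLowerBound.lean` / `PseudospectralEnclosureUnbounded.lean` (`HasBoundedInverse`,
`resolventShift`, `MemSpectrum`).

A validated computation certifies bounded inverses of `L − z₀` with `‖(L − z₀)⁻¹‖ ≤ M₀` only at FINITELY many
points `z₀` of a contour. The passage to the whole contour is the quantitative form of the stability of bounded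
invertibility (Neumann series; Kato IV-§3.1, Trefethen–Embree 2005 Thm. 4.1):

* `norm_oneSub_inv_le` — `‖(1 − t)⁻¹‖ ≤ (1 − ‖t‖)⁻¹` for `‖t‖ < 1` in `E →L[𝕜] E`;
* `HasBoundedInverse.exists_shift_norm_le` — if `‖(L − z₀)⁻¹‖ ≤ M₀`, `‖z − z₀‖ ≤ d` and `d M₀ < 1`, then
  `L − z` has a bounded inverse of norm `≤ M₀ / (1 − d M₀)` [cite: Kato1966, IV-§3.1];
* `exists_hasBoundedInverse_norm_le_of_net` — the same for every point of a set `s` that is `d`-close to a net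
  `N` on which the bound `M₀` holds;
* `exists_hasBoundedInverse_norm_le_of_bijective`, `exists_hasBoundedInverse_norm_le_of_coercive` — what ONE net
  point requires: a bijection with an a-priori bound `‖u‖ ≤ C‖Tu‖` (resp. `Re ⟪Tu,u⟫ ≥ δ‖u‖²` + surjectivity) has a
  bounded inverse of norm `≤ C` (resp. `≤ δ⁻¹`) [cite: Kato1966, III-§5];
* `exists_mem_closedBall_not_hasBoundedInverse_of_net`, `exists_memSpectrum_closedBall_of_net` — **the
  enclosure from a net**: bounded inverses of norm `≤ M₀` on a `d`-net of the circle `|z − μ| = r` (`r > 0`,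
  `d M₀ < 1`), an approximate eigenvector `v ≠ 0` at `μ` with `‖(L − μ) v‖ ≤ ε ‖v‖`, and `M₀ ε < 1 − d M₀` force a
  point of the closed disc without bounded inverse (a spectral point, for closed `L`)
  [cite: Davies2007, Lemma 9.1.2 with Thm. 9.2.8; TrefethenEmbree2005, Thms. 4.1, 4.3].

Why it is here: it is the exact shape in which a certified-numerics campaign (finitely many certified resolvent
bounds on a circle around a candidate eigenvalue of a non-normal differential operator, plus one certified residual)
yields an eigenvalue enclosure. Everything is proved; nothing about any particular operator is asserted.

## References

* T. Kato, *Perturbation Theory for Linear Operators*, Springer 1966/1976, IV-§3.1. [Kato1966]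
* L. N. Trefethen, M. Embree, *Spectra and Pseudospectra*, Princeton Univ. Press 2005, Thms. 4.1, 4.3. [TrefethenEmbree2005]
* E. B. Davies, *Linear Operators and their Spectra*, Cambridge Univ. Press 2007, Lemma 9.1.2, Thm. 9.2.8. [Davies2007]
-/

noncomputable section

open _root_.Metric _root_.Set _root_.Filter _root_.Topology

namespace Literature.Analysis.OperatorTheory

section General

variable {𝕜 E : Type*} [NontriviallyNormedField 𝕜] [NormedAddCommGroup E] [NormedSpace 𝕜 E]
  [CompleteSpace E]

/-- `‖(1 − t)⁻¹‖ ≤ (1 − ‖t‖)⁻¹` for `‖t‖ < 1` (geometric series; `‖1‖ ≤ 1` for operators). [cite: Kato1966, IV-§3.1] -/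
theorem norm_oneSub_inv_le {t : E →L[𝕜] E} (ht : ‖t‖ < 1) :
    ‖(↑(Units.oneSub t ht)⁻¹ : E →L[𝕜] E)‖ ≤ (1 - ‖t‖)⁻¹ := by
  have h1 : (↑(Units.oneSub t ht)⁻¹ : E →L[𝕜] E) = ∑' n : ℕ, t ^ n := rfl
  rw [h1]
  have h2 := tsum_geometric_le_of_norm_lt_one t ht
  have h3 : ‖(1 : E →L[𝕜] E)‖ ≤ 1 := by
    rw [ContinuousLinearMap.one_def]
    exact ContinuousLinearMap.norm_id_le
  linarith

/-- The norm of the explicit shifted inverse: `‖B (1 − t)⁻¹‖ ≤ ‖B‖ / (1 − ‖t‖)`. [cite: Kato1966, IV-§3.1] -/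
theorem norm_comp_oneSub_inv_le (B : E →L[𝕜] E) {t : E →L[𝕜] E} (ht : ‖t‖ < 1) :
    ‖B.comp (↑(Units.oneSub t ht)⁻¹ : E →L[𝕜] E)‖ ≤ ‖B‖ / (1 - ‖t‖) := by
  have hpos : 0 < 1 - ‖t‖ := by linarith
  calc ‖B.comp (↑(Units.oneSub t ht)⁻¹ : E →L[𝕜] E)‖
      ≤ ‖B‖ * ‖(↑(Units.oneSub t ht)⁻¹ : E →L[𝕜] E)‖ := ContinuousLinearMap.opNorm_comp_le _ _
    _ ≤ ‖B‖ * (1 - ‖t‖)⁻¹ := mul_le_mul_of_nonneg_left (norm_oneSub_inv_le ht) (norm_nonneg _)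
    _ = ‖B‖ / (1 - ‖t‖) := by rw [div_eq_mul_inv]

/-- **Quantitative stability of bounded invertibility**: if `L − z₀` has a bounded inverse of norm `≤ M₀`,
`‖z − z₀‖ ≤ d` and `d M₀ < 1`, then `L − z` has a bounded inverse of norm `≤ M₀ / (1 − d M₀)`.
[cite: Kato1966, IV-§3.1; TrefethenEmbree2005, Thm. 4.1] -/
theorem HasBoundedInverse.exists_shift_norm_le {p : Submodule 𝕜 E} {L : p →ₗ[𝕜] E} {B₀ : E →L[𝕜] E}
    {z₀ : 𝕜} (h : HasBoundedInverse p (resolventShift p L z₀) B₀) {z : 𝕜} {M₀ d : ℝ}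
    (hB : ‖B₀‖ ≤ M₀) (hz : ‖z - z₀‖ ≤ d) (hd : d * M₀ < 1) :
    ∃ B : E →L[𝕜] E, HasBoundedInverse p (resolventShift p L z) B ∧ ‖B‖ ≤ M₀ / (1 - d * M₀) := by
  have hM₀ : 0 ≤ M₀ := (norm_nonneg _).trans hB
  have hdnn : 0 ≤ d := (norm_nonneg _).trans hz
  have ht : ‖(z - z₀) • B₀‖ ≤ d * M₀ := by
    rw [norm_smul]
    exact mul_le_mul hz hB (norm_nonneg _) hdnn
  have ht1 : ‖(z - z₀) • B₀‖ < 1 := lt_of_le_of_lt ht hd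
  refine ⟨_, h.shift ht1, ?_⟩
  have hpos : 0 < 1 - d * M₀ := by linarith
  have hpos' : 0 < 1 - ‖(z - z₀) • B₀‖ := by linarith
  calc ‖B₀.comp (↑(Units.oneSub ((z - z₀) • B₀) ht1)⁻¹ : E →L[𝕜] E)‖
      ≤ ‖B₀‖ / (1 - ‖(z - z₀) • B₀‖) := norm_comp_oneSub_inv_le B₀ ht1
    _ ≤ M₀ / (1 - d * M₀) := by
        rw [div_le_div_iff₀ hpos' hpos]
        nlinarith [norm_nonneg B₀]

/-- **From a net to the whole set**: if every point of `s` is within `d` of a point of `N`, bounded inverses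
of norm `≤ M₀` exist on `N`, and `d M₀ < 1`, then bounded inverses of norm `≤ M₀ / (1 − d M₀)` exist on `s`.
[cite: TrefethenEmbree2005, Thm. 4.1] -/
theorem exists_hasBoundedInverse_norm_le_of_net {p : Submodule 𝕜 E} {L : p →ₗ[𝕜] E} {s N : Set 𝕜}
    {M₀ d : ℝ} (hnet : ∀ z ∈ s, ∃ z₀ ∈ N, ‖z - z₀‖ ≤ d)
    (hinv : ∀ z₀ ∈ N, ∃ B₀ : E →L[𝕜] E, HasBoundedInverse p (resolventShift p L z₀) B₀ ∧ ‖B₀‖ ≤ M₀)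
    (hd : d * M₀ < 1) :
    ∀ z ∈ s, ∃ B : E →L[𝕜] E, HasBoundedInverse p (resolventShift p L z) B ∧ ‖B‖ ≤ M₀ / (1 - d * M₀) := by
  intro z hz
  obtain ⟨z₀, hz₀, hzz₀⟩ := hnet z hz
  obtain ⟨B₀, hB₀, hB₀M⟩ := hinv z₀ hz₀
  exact hB₀.exists_shift_norm_le hB₀M hzz₀ hd


/-! ### Certified inverse bounds from a-priori estimates (what a single net point requires) -/

omit [CompleteSpace E] in
/-- A bijective `T : p → E` obeying the a-priori estimate `‖u‖ ≤ C ‖T u‖` has a bounded inverse of norm `≤ C`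
(no completeness needed). This is the form in which ONE certified linear solve enters the net. [folklore] [cite: Kato1966, III-§5] -/
theorem exists_hasBoundedInverse_norm_le_of_bijective {p : Submodule 𝕜 E} {T : p →ₗ[𝕜] E} {C : ℝ}
    (hC : 0 ≤ C) (hbij : Function.Bijective T) (hbound : ∀ u : p, ‖(u : E)‖ ≤ C * ‖T u‖) :
    ∃ B : E →L[𝕜] E, HasBoundedInverse p T B ∧ ‖B‖ ≤ C := by
  let e : p ≃ₗ[𝕜] E := LinearEquiv.ofBijective T hbij
  have he : ∀ u : p, e u = T u := fun u => rfl
  let g : E →ₗ[𝕜] E := p.subtype ∘ₗ (e.symm : E →ₗ[𝕜] p)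
  have hg_apply : ∀ f : E, g f = ((e.symm f : p) : E) := fun f => rfl
  have hgb : ∀ f : E, ‖g f‖ ≤ C * ‖f‖ := fun f => by
    rw [hg_apply]
    have h := hbound (e.symm f)
    rwa [← he, LinearEquiv.apply_symm_apply] at h
  let B : E →L[𝕜] E := g.mkContinuous C hgb
  have hB_apply : ∀ f : E, B f = ((e.symm f : p) : E) := fun f => rfl
  have hBmem : ∀ f : E, B f ∈ p := fun f => by rw [hB_apply]; exact (e.symm f).2
  refine ⟨B, ⟨hBmem, fun f => ?_, fun u => ?_⟩, ?_⟩
  · have h1 : (⟨B f, hBmem f⟩ : p) = e.symm f := by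
      ext
      rfl
    rw [h1, ← he, LinearEquiv.apply_symm_apply]
  · rw [hB_apply, ← he, LinearEquiv.symm_apply_apply]
  · exact LinearMap.mkContinuous_norm_le _ hC _

end General

section Coercive

variable {𝕜 E : Type*} [RCLike 𝕜] [NormedAddCommGroup E] [InnerProductSpace 𝕜 E]

open scoped InnerProductSpace in
/-- **Coercive solve** (Lax–Milgram direction used by energy-method certificates): if `Re ⟪T u, u⟫ ≥ δ ‖u‖²` on `p`
with `δ > 0` and `T` is surjective, then `T` has a bounded inverse of norm `≤ δ⁻¹`. Surjectivity is a separate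
hypothesis (for a closed operator it follows e.g. from the same estimate for the adjoint, or from a Fredholm
index-zero statement). [folklore] [cite: Kato1966, VI-§1 and III-§5] -/
theorem exists_hasBoundedInverse_norm_le_of_coercive {p : Submodule 𝕜 E} {T : p →ₗ[𝕜] E} {δ : ℝ}
    (hδ : 0 < δ) (hcoer : ∀ u : p, δ * ‖(u : E)‖ ^ 2 ≤ RCLike.re ⟪T u, (u : E)⟫_𝕜)
    (hsurj : Function.Surjective T) :
    ∃ B : E →L[𝕜] E, HasBoundedInverse p T B ∧ ‖B‖ ≤ δ⁻¹ := by
  have hbound : ∀ u : p, ‖(u : E)‖ ≤ δ⁻¹ * ‖T u‖ := by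
    intro u
    have h1 : δ * ‖(u : E)‖ ^ 2 ≤ ‖T u‖ * ‖(u : E)‖ :=
      (hcoer u).trans ((RCLike.re_le_norm _).trans (norm_inner_le_norm _ _))
    by_cases hu : ‖(u : E)‖ = 0
    · rw [hu]; positivity
    · have hpos : 0 < ‖(u : E)‖ := lt_of_le_of_ne (norm_nonneg _) (Ne.symm hu)
      have h2 : δ * ‖(u : E)‖ ≤ ‖T u‖ := by
        have h3 : δ * ‖(u : E)‖ * ‖(u : E)‖ ≤ ‖T u‖ * ‖(u : E)‖ := by rw [mul_assoc, ← sq]; exact h1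
        exact le_of_mul_le_mul_right h3 hpos
      rw [le_inv_mul_iff₀ hδ]
      exact h2
  have hinj : Function.Injective T := by
    intro u v huv
    have h0 : T (u - v) = 0 := by rw [map_sub, huv, sub_self]
    have h1 := hbound (u - v)
    rw [h0, norm_zero, mul_zero] at h1
    have h2 : ((u - v : p) : E) = 0 := norm_le_zero_iff.mp h1
    exact sub_eq_zero.mp (by exact_mod_cast h2)
  exact exists_hasBoundedInverse_norm_le_of_bijective (inv_nonneg.mpr hδ.le) ⟨hinj, hsurj⟩ hbound

end Coercive

section Enclosure

variable {E : Type*} [NormedAddCommGroup E] [NormedSpace ℂ E] [CompleteSpace E]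
  {p : Submodule ℂ E} {L : p →ₗ[ℂ] E}

/-- **Pseudospectral enclosure from a finite net of certified inverse bounds.** Let `r > 0` and let `N` be a
set of points such that every point of the circle `|z − μ| = r` is within `d` of `N`; suppose `L − z₀` has a
bounded inverse of norm `≤ M₀` at every `z₀ ∈ N`, with `d M₀ < 1`. If some `v ∈ p`, `v ≠ 0`, has
`‖(L − μ) v‖ ≤ ε ‖v‖` and `M₀ ε < 1 − d M₀`, then some point of the closed disc `|z − μ| ≤ r` carries no bounded
inverse of `L − z`. [cite: Davies2007, Lemma 9.1.2 with Thm. 9.2.8; TrefethenEmbree2005, Thms. 4.1, 4.3] -/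
theorem exists_mem_closedBall_not_hasBoundedInverse_of_net {μ : ℂ} {r M₀ d ε : ℝ} (hr : 0 < r) {N : Set ℂ}
    (hnet : ∀ z ∈ sphere μ r, ∃ z₀ ∈ N, ‖z - z₀‖ ≤ d)
    (hinv : ∀ z₀ ∈ N, ∃ B₀ : E →L[ℂ] E, HasBoundedInverse p (resolventShift p L z₀) B₀ ∧ ‖B₀‖ ≤ M₀)
    (hd : d * M₀ < 1) {v : p} (hv : v ≠ 0) (hres : ‖resolventShift p L μ v‖ ≤ ε * ‖(v : E)‖)
    (hε : M₀ * ε < 1 - d * M₀) :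
    ∃ z ∈ closedBall μ r, ∀ B : E →L[ℂ] E, ¬ HasBoundedInverse p (resolventShift p L z) B := by
  have hM := exists_hasBoundedInverse_norm_le_of_net hnet hinv hd
  have hpos : 0 < 1 - d * M₀ := by linarith
  have hMε : M₀ / (1 - d * M₀) * ε < 1 := by
    rw [div_mul_eq_mul_div, div_lt_one hpos]
    exact hε
  exact exists_mem_closedBall_not_hasBoundedInverse hr hM hv hres hMε

/-- The same for a CLOSED operator, with the conclusion `MemSpectrum p L z` (`L − z` not bijective).
[cite: Davies2007, Lemma 9.1.2 with Thm. 9.2.8; TrefethenEmbree2005, Thms. 4.1, 4.3] -/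
theorem exists_memSpectrum_closedBall_of_net (hL : IsClosed {x : E × E | ∃ u : p, ((u : E), L u) = x})
    {μ : ℂ} {r M₀ d ε : ℝ} (hr : 0 < r) {N : Set ℂ}
    (hnet : ∀ z ∈ sphere μ r, ∃ z₀ ∈ N, ‖z - z₀‖ ≤ d)
    (hinv : ∀ z₀ ∈ N, ∃ B₀ : E →L[ℂ] E, HasBoundedInverse p (resolventShift p L z₀) B₀ ∧ ‖B₀‖ ≤ M₀)
    (hd : d * M₀ < 1) {v : p} (hv : v ≠ 0) (hres : ‖resolventShift p L μ v‖ ≤ ε * ‖(v : E)‖)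
    (hε : M₀ * ε < 1 - d * M₀) :
    ∃ z ∈ closedBall μ r, MemSpectrum p L z := by
  obtain ⟨z, hz, hno⟩ := exists_mem_closedBall_not_hasBoundedInverse_of_net hr hnet hinv hd hv hres hε
  refine ⟨z, hz, fun hbij => ?_⟩
  obtain ⟨B, hB⟩ := hasBoundedInverse_of_bijective_of_isClosed_graph hL hbij
  exact hno B hB

end Enclosure

end Literature.Analysis.OperatorTheory
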